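import Mathlib
import HarnessLib
import Summits.QuantumFields.YangMills.Theorems.LangevinControlUVFemtoCurvatureSkewnessTreeRatioFloorBinomial

/-!
# `FemtoCurvatureSkewness` — binomial toolkit II for stub `TreeRatioFloor` (crux stmt-QuantumFields-9365)

Shape of the binomial rows `C(2i, ·)` and `C(m, ·)` used by the lazy-walk representation of the transverse torus
propagator:

* unimodality towards the centre (`choose_le_choose_of_abs_le`), and the central-block average bound
  `(m-2a+1) 2^m ≤ (m+1) Σ_{a ≤ j ≤ m-a} C(m,j)` (`block_sum_ge`);
* the quarter-tail bound `Σ_{4j ≤ m} C(m,j) ≤ (4c/3)^m` with `c = 3^{1/4}`, so that `(4c/3)/2 < 1` (`sum_choose_quarter_le`);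
* the binomial average `Σ_j C(m,j) p_j p_{m-j} ≤ 2^{m+1}/(m+1)` of the central weights `p_j = C(2j,j)/4^j`;
* double counting through a map with fibres of size at most two.

All statements are over `ℝ`; Mathlib only.
-/

noncomputable section

namespace Summit.QuantumFields.YangMills.Theorems.FemtoCurvatureSkewness

open Finset
open scoped BigOperators

namespace TreeRatio

/-! ## Unimodality -/

/-- On the row `C(2i, ·)`, coefficients closer to the centre `i` are larger:
`|s' - i| ≤ |s - i|` implies `C(2i, s) ≤ C(2i, s')`. -/
theorem choose_le_choose_of_abs_le (i s s' : ℕ) (h : |(s' : ℤ) - i| ≤ |(s : ℤ) - i|) :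
    (2 * i).choose s ≤ (2 * i).choose s' := by
  -- `C(N, ·)` is non-decreasing on `[0, N/2]`
  have mono : ∀ {N r r' : ℕ}, r ≤ r' → r' ≤ N / 2 → N.choose r ≤ N.choose r' := by
    intro N r r' hrr' hr'
    induction r', hrr' using Nat.le_induction with
    | base => exact le_rfl
    | succ k hk ih => exact (ih (by omega)).trans (Nat.choose_le_succ_of_lt_half_left (by omega))
  -- fold both indices into `[0, i]`
  have key : ∀ t : ℕ, t ≤ 2 * i → ∃ u : ℕ, u ≤ i ∧ (2 * i).choose t = (2 * i).choose u ∧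
      ((i : ℤ) - u = |(t : ℤ) - i|) := by
    intro t ht
    rcases le_total t i with hti | hti
    · refine ⟨t, hti, rfl, ?_⟩
      rw [abs_of_nonpos (by omega)]; ring
    · refine ⟨2 * i - t, by omega, (Nat.choose_symm ht).symm, ?_⟩
      rw [abs_of_nonneg (by omega)]; omega
  by_cases hs : s ≤ 2 * i
  · by_cases hs' : s' ≤ 2 * i
    · obtain ⟨u, hu, hcu, hdu⟩ := key s hs
      obtain ⟨u', hu', hcu', hdu'⟩ := key s' hs'
      rw [hcu, hcu']
      exact mono (by omega) (by omega)
    · -- `s' > 2i` forces `|s - i| > i`, i.e. `s > 2i`: contradiction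
      exfalso
      rw [abs_of_nonneg (by omega)] at h
      have : (i : ℤ) < |(s : ℤ) - i| := by omega
      rcases le_total s i with hsi | hsi
      · rw [abs_of_nonpos (by omega)] at this; omega
      · rw [abs_of_nonneg (by omega)] at this; omega
  · rw [Nat.choose_eq_zero_of_lt (by omega)]
    exact Nat.zero_le _

/-- In the row `C(m, ·)`, every coefficient outside the central block `[a, m-a]` is at most `C(m, a)`. -/
theorem choose_le_choose_of_lt_block {m a j : ℕ} (ha : 2 * a ≤ m) (hj : j < a ∨ m - a < j) :
    m.choose j ≤ m.choose a := by
  -- `C(N, ·)` is non-decreasing on `[0, N/2]`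
  have mono : ∀ {N r r' : ℕ}, r ≤ r' → r' ≤ N / 2 → N.choose r ≤ N.choose r' := by
    intro N r r' hrr' hr'
    induction r', hrr' using Nat.le_induction with
    | base => exact le_rfl
    | succ k hk ih => exact (ih (by omega)).trans (Nat.choose_le_succ_of_lt_half_left (by omega))
  rcases hj with hj | hj
  · exact mono hj.le (by omega)
  · by_cases hjm : j ≤ m
    · rw [← Nat.choose_symm hjm]
      exact mono (by omega) (by omega)
    · rw [Nat.choose_eq_zero_of_lt (by omega)]; exact Nat.zero_le _

/-- In the row `C(m, ·)`, every coefficient inside the central block `[a, m-a]` is at least `C(m, a)`. -/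
theorem choose_block_ge {m a j : ℕ} (ha : 2 * a ≤ m) (hj1 : a ≤ j) (hj2 : j ≤ m - a) :
    m.choose a ≤ m.choose j := by
  -- `C(N, ·)` is non-decreasing on `[0, N/2]`
  have mono : ∀ {N r r' : ℕ}, r ≤ r' → r' ≤ N / 2 → N.choose r ≤ N.choose r' := by
    intro N r r' hrr' hr'
    induction r', hrr' using Nat.le_induction with
    | base => exact le_rfl
    | succ k hk ih => exact (ih (by omega)).trans (Nat.choose_le_succ_of_lt_half_left (by omega))
  rcases Nat.lt_or_ge (m / 2) j with h | h
  · rw [← Nat.choose_symm (show j ≤ m by omega)]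
    exact mono (by omega) (by omega)
  · exact mono hj1 h

/-- **Central-block average bound.** The central block `[a, m-a]` of the row `C(m, ·)` carries at least its
proportional share of the total mass `2^m`: `(m - 2a + 1) 2^m ≤ (m + 1) Σ_{a ≤ j ≤ m-a} C(m, j)`. -/
theorem block_sum_ge (m a : ℕ) (ha : 2 * a ≤ m) :
    ((m : ℝ) - 2 * a + 1) * 2 ^ m ≤ ((m : ℝ) + 1) * ∑ j ∈ Icc a (m - a), (m.choose j : ℝ) := by
  -- in `ℕ`: with `S` the block sum, `b = m - 2a + 1` its length and `μ = C(m,a)` its minimum,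
  -- `2^m = S + S'`, `S' ≤ (m + 1 - b) μ`, `b μ ≤ S`.
  set B : Finset ℕ := Icc a (m - a) with hB
  have hBsub : B ⊆ range (m + 1) := by
    intro j hj; simp only [hB, mem_Icc] at hj; simp only [mem_range]; omega
  have hcardB : B.card = m - 2 * a + 1 := by simp only [hB, Nat.card_Icc]; omega
  have htot : ∑ j ∈ range (m + 1), m.choose j = 2 ^ m := Nat.sum_range_choose m
  have hsplit := (sum_sdiff hBsub (f := fun j => m.choose j))
  -- outside the block
  have hout : ∑ j ∈ range (m + 1) \ B, m.choose j ≤ (m + 1 - (m - 2 * a + 1)) * m.choose a := by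
    have hcard : (range (m + 1) \ B).card = m + 1 - (m - 2 * a + 1) := by
      rw [card_sdiff_of_subset hBsub, card_range, hcardB]
    rw [← hcard, ← smul_eq_mul, ← sum_const]
    refine sum_le_sum fun j hj => ?_
    simp only [mem_sdiff, mem_range, hB, mem_Icc, not_and_or, not_le] at hj
    exact choose_le_choose_of_lt_block ha (by omega)
  -- inside the block
  have hin : (m - 2 * a + 1) * m.choose a ≤ ∑ j ∈ B, m.choose j := by
    rw [← hcardB, ← smul_eq_mul, ← sum_const]
    refine sum_le_sum fun j hj => ?_
    simp only [hB, mem_Icc] at hj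
    exact choose_block_ge ha hj.1 hj.2
  have hnat : (m - 2 * a + 1) * 2 ^ m ≤ (m + 1) * ∑ j ∈ B, m.choose j := by
    have h1 : 2 ^ m = ∑ j ∈ range (m + 1) \ B, m.choose j + ∑ j ∈ B, m.choose j := by rw [hsplit, htot]
    have hb : m - 2 * a + 1 ≤ m + 1 := by omega
    calc (m - 2 * a + 1) * 2 ^ m
        = (m - 2 * a + 1) * ∑ j ∈ range (m + 1) \ B, m.choose j + (m - 2 * a + 1) * ∑ j ∈ B, m.choose j := by
          rw [h1, mul_add]
      _ ≤ (m - 2 * a + 1) * ((m + 1 - (m - 2 * a + 1)) * m.choose a) + (m - 2 * a + 1) * ∑ j ∈ B, m.choose j :=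
          by gcongr
      _ = (m + 1 - (m - 2 * a + 1)) * ((m - 2 * a + 1) * m.choose a) + (m - 2 * a + 1) * ∑ j ∈ B, m.choose j := by
          ring
      _ ≤ (m + 1 - (m - 2 * a + 1)) * ∑ j ∈ B, m.choose j + (m - 2 * a + 1) * ∑ j ∈ B, m.choose j := by
          gcongr
      _ = (m + 1) * ∑ j ∈ B, m.choose j := by
          rw [← add_mul]; congr 1; omega
  have hcast : ((m : ℝ) - 2 * a + 1) = ((m - 2 * a + 1 : ℕ) : ℝ) := by
    push_cast [Nat.cast_sub (show 2 * a ≤ m from ha)]; ring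
  rw [hcast]
  exact_mod_cast hnat

/-! ## The quarter tail -/

/-- The constant `c = 3^{1/4}`. -/
def quarterRoot : ℝ := (3 : ℝ) ^ ((1 : ℝ) / 4)

/-- `c = 3^{1/4}` is positive. -/
theorem quarterRoot_pos : 0 < quarterRoot := Real.rpow_pos_of_pos (by norm_num) _

/-- `c⁴ = 3`. -/
theorem quarterRoot_pow_four : quarterRoot ^ 4 = 3 := by
  rw [quarterRoot, ← Real.rpow_natCast, ← Real.rpow_mul (by norm_num)]
  norm_num

/-- `1 ≤ c`. -/
theorem one_le_quarterRoot : 1 ≤ quarterRoot :=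
  Real.one_le_rpow (by norm_num) (by norm_num)

/-- `2c < 3`, i.e. the decay rate `(4c/3)/2 = 2c/3` of the quarter tail is `< 1`. -/
theorem two_mul_quarterRoot_lt_three : 2 * quarterRoot < 3 := by
  by_contra h
  push Not at h
  have h4 : (3 : ℝ) ^ 4 ≤ (2 * quarterRoot) ^ 4 := pow_le_pow_left₀ (by norm_num) h 4
  rw [mul_pow, quarterRoot_pow_four] at h4
  norm_num at h4

/-- **Quarter-tail bound** (Chernoff with parameter `1/3`): `Σ_{j ≤ m/4} C(m, j) ≤ (4c/3)^m`, `c = 3^{1/4}`. -/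
theorem sum_choose_quarter_le (m : ℕ) :
    ∑ j ∈ (range (m + 1)).filter (fun j => 4 * j ≤ m), (m.choose j : ℝ) ≤ (4 * quarterRoot / 3) ^ m := by
  have hc := quarterRoot_pos
  have hc1 := one_le_quarterRoot
  -- `C(m,j) ≤ C(m,j) (1/3)^j c^m` for `4j ≤ m`, since `c^m ≥ c^{4j} = 3^j`
  have hterm : ∀ j ∈ (range (m + 1)).filter (fun j => 4 * j ≤ m),
      (m.choose j : ℝ) ≤ (m.choose j : ℝ) * (1 / 3) ^ j * quarterRoot ^ m := by
    intro j hj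
    have hj' : 4 * j ≤ m := (mem_filter.mp hj).2
    have hpow : (3 : ℝ) ^ j ≤ quarterRoot ^ m := by
      calc (3 : ℝ) ^ j = (quarterRoot ^ 4) ^ j := by rw [quarterRoot_pow_four]
        _ = quarterRoot ^ (4 * j) := by rw [← pow_mul]
        _ ≤ quarterRoot ^ m := pow_le_pow_right₀ hc1 hj'
    have h3 : (0 : ℝ) < 3 ^ j := by positivity
    calc (m.choose j : ℝ) = (m.choose j : ℝ) * (1 / 3) ^ j * 3 ^ j := by
          rw [mul_assoc, ← mul_pow]; norm_num
      _ ≤ (m.choose j : ℝ) * (1 / 3) ^ j * quarterRoot ^ m := by gcongr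
  calc ∑ j ∈ (range (m + 1)).filter (fun j => 4 * j ≤ m), (m.choose j : ℝ)
      ≤ ∑ j ∈ (range (m + 1)).filter (fun j => 4 * j ≤ m), (m.choose j : ℝ) * (1 / 3) ^ j * quarterRoot ^ m :=
        sum_le_sum hterm
    _ ≤ ∑ j ∈ range (m + 1), (m.choose j : ℝ) * (1 / 3) ^ j * quarterRoot ^ m :=
        sum_le_sum_of_subset_of_nonneg (filter_subset _ _) (fun j _ _ => by positivity)
    _ = ((1 / 3 : ℝ) + 1) ^ m * quarterRoot ^ m := by
        rw [add_pow, sum_mul]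
        refine sum_congr rfl fun j _ => ?_
        rw [one_pow, mul_one, mul_comm ((1 / 3 : ℝ) ^ j)]
    _ = (4 * quarterRoot / 3) ^ m := by rw [← mul_pow]; congr 1; ring

/-! ## The binomial average of the central weights -/

/-- `Σ_j C(m, j)/(j+1) ≤ 2^{m+1}/(m+1)` (since `(m+1) C(m,j)/(j+1) = C(m+1,j+1)`). -/
theorem sum_choose_div_succ_le (m : ℕ) :
    ∑ j ∈ range (m + 1), (m.choose j : ℝ) / ((j : ℝ) + 1) ≤ 2 ^ (m + 1) / ((m : ℝ) + 1) := by
  have hm : (0 : ℝ) < (m : ℝ) + 1 := by positivity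
  have hterm : ∀ j ∈ range (m + 1), (m.choose j : ℝ) / ((j : ℝ) + 1) = ((m + 1).choose (j + 1) : ℝ) / ((m : ℝ) + 1) := by
    intro j _
    have h := Nat.add_one_mul_choose_eq m j
    have h' : ((m : ℝ) + 1) * (m.choose j : ℝ) = ((m + 1).choose (j + 1) : ℝ) * ((j : ℝ) + 1) := by
      exact_mod_cast h
    have hj : (0 : ℝ) < (j : ℝ) + 1 := by positivity
    field_simp
    linarith
  rw [sum_congr rfl hterm, ← sum_div]
  gcongr
  have htot : ∑ j ∈ range (m + 2), ((m + 1).choose j : ℝ) = 2 ^ (m + 1) := by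
    exact_mod_cast Nat.sum_range_choose (m + 1)
  rw [sum_range_succ'] at htot
  have h0 : (0 : ℝ) ≤ ((m + 1).choose 0 : ℝ) := by positivity
  linarith

/-- **Binomial average of the central weights**: `Σ_j C(m,j) p_j p_{m-j} ≤ 2^{m+1}/(m+1)`, `p_j = C(2j,j)/4^j`. -/
theorem sum_choose_mul_centralWeight_le (m : ℕ) :
    ∑ j ∈ range (m + 1), (m.choose j : ℝ) * (((2 * j).choose j : ℝ) / 4 ^ j) *
        (((2 * (m - j)).choose (m - j) : ℝ) / 4 ^ (m - j)) ≤ 2 ^ (m + 1) / ((m : ℝ) + 1) := by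
  set p : ℕ → ℝ := fun j => ((2 * j).choose j : ℝ) / 4 ^ j with hp
  have hp2 : ∀ j, p j ^ 2 ≤ 1 / ((j : ℝ) + 1) := by
    intro j
    have h := centralWeight_sq_mul_le j
    have hj : (0 : ℝ) < (j : ℝ) + 1 := by positivity
    rw [le_div_iff₀ hj]
    calc p j ^ 2 * ((j : ℝ) + 1) ≤ p j ^ 2 * (2 * j + 1) := by
          refine mul_le_mul_of_nonneg_left (by linarith [(Nat.cast_nonneg j : (0 : ℝ) ≤ j)]) (sq_nonneg _)
      _ ≤ 1 := h
  -- AM–GM: `p_j p_{m-j} ≤ (p_j² + p_{m-j}²)/2`, and the two resulting sums agree by `j ↦ m - j`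
  have hamgm : ∀ j ∈ range (m + 1), (m.choose j : ℝ) * p j * p (m - j) ≤
      ((m.choose j : ℝ) * p j ^ 2 + (m.choose j : ℝ) * p (m - j) ^ 2) / 2 := by
    intro j _
    have hc : (0 : ℝ) ≤ m.choose j := by positivity
    nlinarith [sq_nonneg (p j - p (m - j))]
  have hrefl : ∑ j ∈ range (m + 1), (m.choose j : ℝ) * p (m - j) ^ 2 = ∑ j ∈ range (m + 1), (m.choose j : ℝ) * p j ^ 2 := by
    rw [← sum_range_reflect]
    refine sum_congr rfl fun j hj => ?_
    have hj : j ≤ m := Nat.lt_succ_iff.mp (mem_range.mp hj)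
    have e1 : m + 1 - 1 - j = m - j := by omega
    rw [e1, Nat.sub_sub_self hj, Nat.choose_symm hj]
  have hsq : ∑ j ∈ range (m + 1), (m.choose j : ℝ) * p j ^ 2 ≤ 2 ^ (m + 1) / ((m : ℝ) + 1) := by
    calc ∑ j ∈ range (m + 1), (m.choose j : ℝ) * p j ^ 2 ≤ ∑ j ∈ range (m + 1), (m.choose j : ℝ) / ((j : ℝ) + 1) := by
          refine sum_le_sum fun j _ => ?_
          rw [div_eq_mul_one_div]
          exact mul_le_mul_of_nonneg_left (hp2 j) (by positivity)
      _ ≤ 2 ^ (m + 1) / ((m : ℝ) + 1) := sum_choose_div_succ_le m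
  calc ∑ j ∈ range (m + 1), (m.choose j : ℝ) * p j * p (m - j)
      ≤ ∑ j ∈ range (m + 1), ((m.choose j : ℝ) * p j ^ 2 + (m.choose j : ℝ) * p (m - j) ^ 2) / 2 := sum_le_sum hamgm
    _ = ∑ j ∈ range (m + 1), (m.choose j : ℝ) * p j ^ 2 := by
        rw [← sum_div, sum_add_distrib, hrefl]; ring
    _ ≤ 2 ^ (m + 1) / ((m : ℝ) + 1) := hsq

/-! ## Double counting through a map with fibres of size at most two -/

/-- If `ψ` has fibres of size `≤ 2` on `S` and `f ≥ 0`, then `Σ_{s ∈ S} f(ψ s) ≤ 2 Σ_{s' ∈ ψ(S)} f(s')`. -/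
theorem sum_comp_le_two_mul {ι κ : Type*} [DecidableEq κ] (S : Finset ι) (ψ : ι → κ) (f : κ → ℝ)
    (hf : ∀ k, 0 ≤ f k) (hfib : ∀ k ∈ S.image ψ, (S.filter (fun s => ψ s = k)).card ≤ 2) :
    ∑ s ∈ S, f (ψ s) ≤ 2 * ∑ k ∈ S.image ψ, f k := by
  rw [sum_comp, mul_sum]
  refine sum_le_sum fun k hk => ?_
  rw [nsmul_eq_mul]
  exact mul_le_mul_of_nonneg_right (by exact_mod_cast hfib k hk) (hf k)

end TreeRatio

/-- **Central-block average bound** (registered sub-goal `TreeRatioBlockAverage`): `(m-2a+1) 2^m ≤ (m+1) Σ_{a ≤ j ≤ m-a} C(m,j)`. -/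
theorem TreeRatioBlockAverage : ∀ (m a : ℕ), 2 * a ≤ m → ((m : ℝ) - 2 * a + 1) * 2 ^ m ≤ ((m : ℝ) + 1) * ∑ j
    ∈ Finset.Icc a (m - a), (m.choose j : ℝ) :=
  fun m a ha => TreeRatio.block_sum_ge m a ha

end Summit.QuantumFields.YangMills.Theorems.FemtoCurvatureSkewness

end
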